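import Literature.MathematicalPhysics.QuantumFieldTheory.Balaban1983to89.B16Exp198
import Literature.MathematicalPhysics.QuantumFieldTheory.Balaban1983to89.T4WeightBudgetKP

/-!
# T4PinnedGasOfGeometry — liaison between the per-step polymer geometry of (1.90) (`B16Exp198.Geometry`) and the
pinned Kotecký–Preiss gas of node U5c (`T4WeightBudgetKP.PinnedGas`) (cell `pub-balaban`, T4-DAG §2 U5c; bookkeeping)

HONEST FRAMING (cell `pub-balaban`, T4-DAG PAGE 1).  The cell's T4 target is the existence AND uniqueness of the
continuum limit of Bałaban's unit-scale averaged loop expectations on a FIXED finite torus — strictly beyond ultraviolet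
stability ([Balaban1989LargeFieldII] Thm 1 p. 355); it is NOT the Yang–Mills mass gap and NOT the Clay problem.  This
module is an INTERFACE LIAISON between two landed cell objects and proves NO estimate of the series:

* `B16Exp198.Geometry S Cube` (module `B16Exp198`, Part E) — the per-step polymer geometry of the gas (1.90) p. 388 of
  [Balaban1989LargeFieldII] over unit b02's `B16.RelDomainSys`: catalogue `adm`, M-cubes `cubes`, the cubes `Yfix` of the
  fixed class-2 components, an incompatibility `ι` (reflexive, symmetric, local INTO the outside parts through `reach`),
  and the three relative leaves (1.26)_rel (`ineq126`, rate `κ₀`, constant `K₀`), the relative volume bound (`volBound`,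
  constant `c₀`) and `relSubadd`;
* `T4WeightBudgetKP.PinnedGas` (module `T4WeightBudgetKP`, §1) — an abstract hard-core polymer gas with NON-NEGATIVE real
  activities, a Kotecký–Preiss size function, a finite volume and a pinned set, whose pinned class has relative weight
  `bad ≤ (1 − e^{−pinnedSize}) · total` under the KP condition `PinnedGas.IsKP` (`PinnedGas.bad_le_of_kp`, from the tree's
  [KoteckyPreiss1986] layer).

WHAT IS PROVED (kernel, no `sorry`).
§1 `geomGas`: a geometry, ANY family of non-negative real activities `x` on its domains, a rate `τ` and a
   pinned set `D ⊆ adm` ASSEMBLE into a `PinnedGas` (polymers `S.Dom`, incompatibility `G.ι`, size function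
   `a Z = τ · #(cubes Z ∖ Yfix)`, volume `adm`).  The incompatibility needs no decidability datum: classical instances.
§2 `isKP_geomGas`: if `x Z ≤ A · e^{−R · dRel Z}` on `adm` (the SHAPE of (1.97) p. 390, with `A`, `R`
   abstract), `κ₀ + τ c₀ ≤ R` and `A · e^{τ c₀} · K₀ · ν ≤ τ`, the assembled gas satisfies `PinnedGas.IsKP` — BY NAME from
   `B16Exp198.kp_condition_rel` (the [KP86] hypothesis (1) for the gas (1.90) in relative form, already in the tree) at
   `s = b = 0`, restricted from `Finset.univ` to the catalogue.
§3 `pinnedSize_geomGas_le_of_anchor`: for a pinned set ANCHORED at one outside cube `q` (every `Z ∈ D` owns `q`,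
   `q ∉ Yfix`) the pinned size is `≤ A · e^{τ c₀} · K₀` (the leaf (1.26)_rel once); hence (`bad_geomGas_le_of_anchor`, by
   `PinnedGas.bad_le_of_kp_of_le`) the compatible families of (1.90)-polymers touching `q` carry relative weight
   `≤ 1 − exp(−A e^{τ c₀} K₀) ≤ A e^{τ c₀} K₀` — linear in the activity scale `A`.

THE INTERFACE VERDICT this liaison records (question of the pv14 lineage to the pv10 lineage, journal 2026-08-18
21:27:33Z: "does `PinnedGas`/`PolymerRep` sit correctly against your `Geometry` of (1.90)?").
(V1) TYPES ALIGN: polymers `P ↦ S.Dom`, incompatibility `inc ↦ G.ι` (reflexive and symmetric on both sides; `PinnedGas`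
     wants decidability, supplied classically), volume `Λ ↦ G.adm`, pinned set `D ↦` any sub-family of `adm`; and the KP
     criterion of the tree (`IsKPVolume`: `Σ_{γ' ι γ} ‖w γ'‖ e^{a γ'} ≤ a γ`) is MET by the geometry's own leaves
     ((1.26)_rel + relative volume bound + locality of `ι`), §2 — so the two objects are compatible, and neither is an
     instance of the other.
(V2) SIGN / CODOMAIN MISMATCH (honest): the activities the geometry is used with in `B16Exp198` are `F : S.Dom → Φ → ℂ`
     (the analytic functions of (1.91) on the spaces Ũ^c_k), complex in general and SIGNED at real fields (they come out of
     the Mayer interpolation `∫₀¹ dt(Y) …` of (1.91)); `PinnedGas` requires `x ≥ 0`.  The liaison therefore runs through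
     `x := ‖F · φ‖` or through any non-negative dominating family — which is exactly the currency of the pv14 lineage's
     corrected hypothesis shape `T4WeightBudgetKP.PolymerDom` (domination, v2) rather than of the exact `PolymerRep`.
(V3) LEVEL MISMATCH (honest): `Geometry` is the gas of ONE renormalization step `k` with the class-2 components
     `⋃_i Y_i` FIXED; node U5c's pinned set is history-indexed at fixed `(K, t)` (cell GAPS G-pv14-8 (i)).  Nothing here
     builds the history-indexed gas; §3 is the per-step shape of "the histories touching a given large-field cube are rare".
(V4) NO CONFLICT: the two modules share no declaration; this file imports both and adds only the liaison.

NOT PRINTED, NOT ASSERTED: that Bałaban's (1.91) activities are non-negative, that the per-step gases compose into U5c's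
history-indexed gas, or any value of `A`, `R`, `τ`.  No quotation of the papers is added here (the printed sentences this
rests on are quoted in `B16Exp198`, renders p034/p036 of [Balaban1989LargeFieldII], and in `T4WeightBudgetKP`).
NEW LEAF MODULE of the pv10 lineage (unit `b2b-balaban-pv10-g5`); imports `B16Exp198` and `T4WeightBudgetKP` only; no
existing module is touched.  Value = interface liaison (informational), NOT summit progress.
-/

namespace Literature.MathematicalPhysics.QuantumFieldTheory.Balaban1983to89.T4PinnedGasOfGeometry

open Finset
open _root_.Literature.Probability.LatticeModels
open Literature.MathematicalPhysics.QuantumFieldTheory.Balaban1983to89.B13FamilySum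
open Literature.MathematicalPhysics.QuantumFieldTheory.Balaban1983to89.T4WeightBudgetKP
open Literature.MathematicalPhysics.QuantumFieldTheory.Balaban1983to89.B16Exp198

variable {S : B16.RelDomainSys} {Cube : Type} [DecidableEq Cube] (G : Geometry S Cube)

/-! ## §1 The pinned gas of a geometry with non-negative activities -/

/-- **The pinned KP gas assembled from the geometry of (1.90).**  Polymers = the domains `S.Dom`, incompatibility = `G.ι`
(classical decidability), activities = a given NON-NEGATIVE real family `x`, Kotecký–Preiss size function
`a Z = τ · #(cubes Z ∖ Yfix)` (proportional to the number of OUTSIDE cubes, the currency of `kp_condition_rel`), volume =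
the catalogue `adm`, pinned set = any `D ⊆ adm`.  A construction; nothing about [Balaban1989LargeFieldII] is asserted.
[folklore] -/
noncomputable def geomGas (x : S.Dom → ℝ) (hx : ∀ Z, 0 ≤ x Z) (τ : ℝ) (D : Finset S.Dom) (hD : D ⊆ G.adm) :
    PinnedGas where
  P := S.Dom
  decEq := Classical.decEq _
  inc := G.ι
  decRel := Classical.decRel _
  refl := ⟨G.ι_refl⟩
  symm := ⟨G.ι_symm⟩
  x := x
  a := fun Z => τ * (((G.cubes Z \ G.Yfix).card : ℕ) : ℝ)
  Λ := G.adm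
  D := D
  x_nonneg := hx
  D_subset := hD

section

variable {G}
variable {x : S.Dom → ℝ} {hx : ∀ Z, 0 ≤ x Z} {τ : ℝ} {D : Finset S.Dom} {hD : D ⊆ G.adm}

/-- The assembled gas has the catalogue as its volume. [folklore] -/
@[simp] theorem geomGas_Λ : (geomGas G x hx τ D hD).Λ = G.adm := rfl

/-- … the given pinned set. [folklore] -/
@[simp] theorem geomGas_D : (geomGas G x hx τ D hD).D = D := rfl

/-- … the geometry's incompatibility. [folklore] -/
@[simp] theorem geomGas_inc : (geomGas G x hx τ D hD).inc = G.ι := rfl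

/-- … the size function `τ · #(cubes Z ∖ Yfix)`. [folklore] -/
@[simp] theorem geomGas_a (Z : S.Dom) :
    (geomGas G x hx τ D hD).a Z = τ * (((G.cubes Z \ G.Yfix).card : ℕ) : ℝ) := rfl

/-- … and complexified activities of norm `x Z`. [folklore] -/
theorem norm_geomGas_w (Z : S.Dom) : ‖(geomGas G x hx τ D hD).w Z‖ = x Z := by
  show ‖((x Z : ℝ) : ℂ)‖ = x Z
  rw [Complex.norm_real, Real.norm_eq_abs, abs_of_nonneg (hx Z)]

/-- The KP size of a polymer of the assembled gas: `x Z · exp(τ · #(cubes Z ∖ Yfix))`. [folklore] -/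
theorem kpTerm_geomGas (Z : S.Dom) :
    kpTerm (geomGas G x hx τ D hD).w (geomGas G x hx τ D hD).a Z
      = x Z * Real.exp (τ * (((G.cubes Z \ G.Yfix).card : ℕ) : ℝ)) := by
  rw [kpTerm, norm_geomGas_w]
  rfl

end

/-! ## §2 The Kotecký–Preiss condition from the geometry's leaves -/

/-- **THE KP CONDITION OF THE ASSEMBLED GAS** — by name from `B16Exp198.kp_condition_rel` (the [KP86] hypothesis (1)
for the polymer gas (1.90) in relative form) at `s = b = 0`: if the non-negative activities satisfy the (1.97)-SHAPE bound
`x Z ≤ A · exp(−R · dRel Z)` on the catalogue, the rate condition `κ₀ + τ c₀ ≤ R` and the smallness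
`A · e^{τ c₀} · K₀ · ν ≤ τ` hold (`A, τ ≥ 0`), then `(geomGas G x hx τ D hD).IsKP` for every pinned set `D ⊆ adm`.
The constants `A`, `R`, `τ` are abstract; nothing printed is asserted beyond what `kp_condition_rel` cites.
[cite: Balaban1989LargeFieldII, p.390 (before (1.98))] -/
theorem isKP_geomGas {x : S.Dom → ℝ} (hx : ∀ Z, 0 ≤ x Z) {τ A R : ℝ} (hτ : 0 ≤ τ) (hA : 0 ≤ A)
    (hxA : ∀ Z ∈ G.adm, x Z ≤ A * Real.exp (-(R * S.dRel Z)))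
    (hrate : G.κ₀ + τ * G.c₀ ≤ R) (hsmall : A * Real.exp (τ * G.c₀) * G.K₀ * G.ν ≤ τ)
    {D : Finset S.Dom} (hD : D ⊆ G.adm) :
    (geomGas G x hx τ D hD).IsKP := by
  classical
  -- the activities truncated to the catalogue, as complex numbers
  set w' : S.Dom → ℂ := fun Z => if Z ∈ G.adm then ((x Z : ℝ) : ℂ) else 0 with hw'
  have hw'Λ : ∀ Z, Z ∉ G.adm → w' Z = 0 := fun Z hZ => by simp [hw', hZ]
  have hw'in : ∀ Z ∈ G.adm, w' Z = ((x Z : ℝ) : ℂ) := fun Z hZ => by simp [hw', hZ]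
  have hw'bd : ∀ Z, ‖w' Z‖ ≤ A * Real.exp (-(R * S.dRel Z)) := by
    intro Z
    by_cases hZ : Z ∈ G.adm
    · rw [hw'in Z hZ, Complex.norm_real, Real.norm_eq_abs, abs_of_nonneg (hx Z)]
      exact hxA Z hZ
    · rw [hw'Λ Z hZ, norm_zero]
      exact mul_nonneg hA (Real.exp_nonneg _)
  -- the lineage's KP condition for the gas (1.90), relative form, at s = b = 0
  have hkp := fun Z => kp_condition_rel G.ι (Λ := G.adm) (out := fun Z => G.cubes Z \ G.Yfix) (reach := G.reach)
    (d := S.dRel) (w := w') (A := A) (R := R) (κ₀ := G.κ₀) (K₀ := G.K₀) (c₁ := G.c₀) (τ := τ) (s := 0) (b := 0)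
    (ν := G.ν) G.loc G.reach_le S.dRel_nonneg hA G.K₀_nonneg hτ hw'Λ hw'bd G.ineq126 G.volBound
    (by linarith) (by simpa using hsmall) Z
  -- unfold the KP condition of the assembled gas and compare the two sums
  unfold PinnedGas.IsKP IsKPVolume
  intro Z _hZ
  have hsub : Finset.filter (fun Z' => (geomGas G x hx τ D hD).inc Z' Z) (geomGas G x hx τ D hD).Λ ⊆
      Finset.filter (fun Z' => (geomGas G x hx τ D hD).inc Z' Z) (Finset.univ : Finset S.Dom) :=
    Finset.filter_subset_filter _ (Finset.subset_univ G.adm)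
  calc ∑ Z' ∈ (geomGas G x hx τ D hD).Λ with (geomGas G x hx τ D hD).inc Z' Z,
          kpTerm (geomGas G x hx τ D hD).w (geomGas G x hx τ D hD).a Z'
      = ∑ Z' ∈ (geomGas G x hx τ D hD).Λ with (geomGas G x hx τ D hD).inc Z' Z,
          ‖w' Z'‖ * Real.exp (τ * (((G.cubes Z' \ G.Yfix).card : ℕ) : ℝ) + (0 * S.dRel Z' + 0)) := by
        refine Finset.sum_congr rfl fun Z' hZ' => ?_
        have hZ'Λ : Z' ∈ G.adm := (Finset.mem_filter.1 hZ').1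
        rw [kpTerm_geomGas, hw'in Z' hZ'Λ, Complex.norm_real, Real.norm_eq_abs, abs_of_nonneg (hx Z')]
        simp only [zero_mul, add_zero]
    _ ≤ ∑ Z' ∈ (Finset.univ : Finset S.Dom) with (geomGas G x hx τ D hD).inc Z' Z,
          ‖w' Z'‖ * Real.exp (τ * (((G.cubes Z' \ G.Yfix).card : ℕ) : ℝ) + (0 * S.dRel Z' + 0)) :=
        Finset.sum_le_sum_of_subset_of_nonneg hsub fun Z' _ _ =>
          mul_nonneg (norm_nonneg _) (Real.exp_nonneg _)
    _ ≤ τ * (((G.cubes Z \ G.Yfix).card : ℕ) : ℝ) := hkp Z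
    _ = (geomGas G x hx τ D hD).a Z := rfl

/-! ## §3 A pinned class anchored at one outside cube is rare -/

/-- **THE PINNED SIZE OF A CLASS ANCHORED AT ONE OUTSIDE CUBE** (the leaf (1.26)_rel spent once): if every pinned polymer
owns the cube `q ∉ Yfix`, the activities have the (1.97)-shape bound `x Z ≤ A · exp(−R · dRel Z)` on the catalogue
(`A ≥ 0`, `τ ≥ 0`) and `κ₀ + τ c₀ ≤ R`, then `pinnedSize ≤ A · e^{τ c₀} · K₀`. [folklore] -/
theorem pinnedSize_geomGas_le_of_anchor {x : S.Dom → ℝ} (hx : ∀ Z, 0 ≤ x Z) {τ A R : ℝ} (hτ : 0 ≤ τ) (hA : 0 ≤ A)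
    (hxA : ∀ Z ∈ G.adm, x Z ≤ A * Real.exp (-(R * S.dRel Z))) (hrate : G.κ₀ + τ * G.c₀ ≤ R)
    {D : Finset S.Dom} (hD : D ⊆ G.adm) {q : Cube} (hq : ∀ Z ∈ D, q ∈ G.cubes Z \ G.Yfix) :
    (geomGas G x hx τ D hD).pinnedSize ≤ A * Real.exp (τ * G.c₀) * G.K₀ := by
  classical
  -- pointwise: x Z e^{τ #out Z} ≤ A e^{τ c₀} e^{-κ₀ dRel Z} on the catalogue
  have hpt : ∀ Z ∈ G.adm, x Z * Real.exp (τ * (((G.cubes Z \ G.Yfix).card : ℕ) : ℝ))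
      ≤ A * Real.exp (τ * G.c₀) * Real.exp (-(G.κ₀ * S.dRel Z)) := by
    intro Z hZ
    have hv : τ * (((G.cubes Z \ G.Yfix).card : ℕ) : ℝ) ≤ τ * (G.c₀ * (1 + S.dRel Z)) :=
      mul_le_mul_of_nonneg_left (G.volBound Z hZ) hτ
    have hd : 0 ≤ S.dRel Z := S.dRel_nonneg Z
    have hexp : -(R * S.dRel Z) + τ * (G.c₀ * (1 + S.dRel Z)) = τ * G.c₀ + -((R - τ * G.c₀) * S.dRel Z) := by
      ring
    calc x Z * Real.exp (τ * (((G.cubes Z \ G.Yfix).card : ℕ) : ℝ))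
        ≤ A * Real.exp (-(R * S.dRel Z)) * Real.exp (τ * (G.c₀ * (1 + S.dRel Z))) :=
          mul_le_mul (hxA Z hZ) (Real.exp_le_exp.2 hv) (Real.exp_nonneg _) (mul_nonneg hA (Real.exp_nonneg _))
      _ = A * Real.exp (τ * G.c₀) * Real.exp (-((R - τ * G.c₀) * S.dRel Z)) := by
          rw [mul_assoc, ← Real.exp_add, hexp, Real.exp_add, ← mul_assoc]
      _ ≤ A * Real.exp (τ * G.c₀) * Real.exp (-(G.κ₀ * S.dRel Z)) := by
          refine mul_le_mul_of_nonneg_left (Real.exp_le_exp.2 (neg_le_neg ?_)) (mul_nonneg hA (Real.exp_nonneg _))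
          exact mul_le_mul_of_nonneg_right (by linarith) hd
  -- the pinned set lies in the polymers of the catalogue owning `q`
  have hDsub : D ⊆ G.adm.filter (fun Z => q ∈ G.cubes Z \ G.Yfix) := fun Z hZ =>
    Finset.mem_filter.2 ⟨hD hZ, hq Z hZ⟩
  calc (geomGas G x hx τ D hD).pinnedSize
      = ∑ Z ∈ D, x Z * Real.exp (τ * (((G.cubes Z \ G.Yfix).card : ℕ) : ℝ)) := by
        rw [PinnedGas.pinnedSize, geomGas_D]
        exact Finset.sum_congr rfl fun Z _ => kpTerm_geomGas (hD := hD) Z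
    _ ≤ ∑ Z ∈ G.adm.filter (fun Z => q ∈ G.cubes Z \ G.Yfix),
          x Z * Real.exp (τ * (((G.cubes Z \ G.Yfix).card : ℕ) : ℝ)) :=
        Finset.sum_le_sum_of_subset_of_nonneg hDsub fun Z _ _ => mul_nonneg (hx Z) (Real.exp_nonneg _)
    _ ≤ ∑ Z ∈ G.adm.filter (fun Z => q ∈ G.cubes Z \ G.Yfix),
          A * Real.exp (τ * G.c₀) * Real.exp (-(G.κ₀ * S.dRel Z)) :=
        Finset.sum_le_sum fun Z hZ => hpt Z (Finset.mem_filter.1 hZ).1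
    _ = A * Real.exp (τ * G.c₀) *
          ∑ Z ∈ G.adm.filter (fun Z => q ∈ G.cubes Z \ G.Yfix), Real.exp (-(G.κ₀ * S.dRel Z)) := by
        rw [Finset.mul_sum]
    _ ≤ A * Real.exp (τ * G.c₀) * G.K₀ :=
        mul_le_mul_of_nonneg_left (G.ineq126 q) (mul_nonneg hA (Real.exp_nonneg _))

/-- **A PINNED CLASS ANCHORED AT ONE OUTSIDE CUBE IS RARE** (§2 + §3 into `PinnedGas.bad_le_of_kp_of_le`): under the KP
hypotheses of `isKP_geomGas`, the compatible families of (1.90)-polymers containing a polymer of a class anchored at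
`q ∉ Yfix` have relative weight `bad ≤ (1 − exp(−A e^{τ c₀} K₀)) · total`. [folklore] -/
theorem bad_geomGas_le_of_anchor {x : S.Dom → ℝ} (hx : ∀ Z, 0 ≤ x Z) {τ A R : ℝ} (hτ : 0 ≤ τ) (hA : 0 ≤ A)
    (hxA : ∀ Z ∈ G.adm, x Z ≤ A * Real.exp (-(R * S.dRel Z)))
    (hrate : G.κ₀ + τ * G.c₀ ≤ R) (hsmall : A * Real.exp (τ * G.c₀) * G.K₀ * G.ν ≤ τ)
    {D : Finset S.Dom} (hD : D ⊆ G.adm) {q : Cube} (hq : ∀ Z ∈ D, q ∈ G.cubes Z \ G.Yfix) :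
    (geomGas G x hx τ D hD).bad ≤ (1 - Real.exp (-(A * Real.exp (τ * G.c₀) * G.K₀))) * (geomGas G x hx τ D hD).total :=
  (geomGas G x hx τ D hD).bad_le_of_kp_of_le (isKP_geomGas G hx hτ hA hxA hrate hsmall hD)
    (pinnedSize_geomGas_le_of_anchor G hx hτ hA hxA hrate hD hq)

/-- … and, linearised, `bad ≤ A e^{τ c₀} K₀ · total` — the per-step shape of "histories touching a given large-field cube
are rare, linearly in the activity scale". [folklore] -/
theorem bad_geomGas_le_of_anchor_linear {x : S.Dom → ℝ} (hx : ∀ Z, 0 ≤ x Z) {τ A R : ℝ} (hτ : 0 ≤ τ) (hA : 0 ≤ A)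
    (hxA : ∀ Z ∈ G.adm, x Z ≤ A * Real.exp (-(R * S.dRel Z)))
    (hrate : G.κ₀ + τ * G.c₀ ≤ R) (hsmall : A * Real.exp (τ * G.c₀) * G.K₀ * G.ν ≤ τ)
    {D : Finset S.Dom} (hD : D ⊆ G.adm) {q : Cube} (hq : ∀ Z ∈ D, q ∈ G.cubes Z \ G.Yfix) :
    (geomGas G x hx τ D hD).bad ≤ (A * Real.exp (τ * G.c₀) * G.K₀) * (geomGas G x hx τ D hD).total := by
  refine (bad_geomGas_le_of_anchor G hx hτ hA hxA hrate hsmall hD hq).trans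
    (mul_le_mul_of_nonneg_right ?_ (geomGas G x hx τ D hD).total_pos.le)
  have := Real.add_one_le_exp (-(A * Real.exp (τ * G.c₀) * G.K₀))
  linarith

end Literature.MathematicalPhysics.QuantumFieldTheory.Balaban1983to89.T4PinnedGasOfGeometry
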